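import Mathlib
import Literature.Combinatorics.Enumerative.SetExponential
import Literature.LinearAlgebra.Matrix.BipartiteForestRecursion

/-!
# The bipartite all-minors matrix-forest formula over `𝔽₂`

**Theorem** (`det_bigN_eq_setExp`). For arc weights `a : V → V → 𝔽₂`, a finite vertex set `D`, and
`y z ℓ : V → 𝔽₂`, with `P = L_D + D_ℓ` (zero row sums plus the diagonal `ℓ`) and the doubled
symmetric matrix `N = [[D_y, Pᵀ], [P, D_z]]`:
`det N = Σ_{π ∈ Partitions(D)} ∏_{B ∈ π} ((Σ_{i∈B} y i) · q_z(B) + q_ℓ(B))`,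
`q_x(B) = Σ_{t ∈ B} x t · κ_t(B)`, `κ_t(B)` = the principal minor of `L_B` deleting `t` (mod-2 count of
spanning arborescences converging to `t`, [ChebotarevAgaev2002, §3 Thm. 1–2]).  Expanding in `y, z`
this is the all minors matrix tree theorem of [Chaiken1982, §2] over `𝔽₂`, packaged as ONE
determinant; at `y = 0` it is the matrix-forest theorem (`det_lap_eq_setExp`).  The induction is a
symmetric deletion–contraction (`det_bigN_rec`, `det_unitize_bigN_rec` of
`BipartiteForestRecursion`) matched on the combinatorial side by the set-exponential calculus of
`SetExponential` (root absorption, pointing, pivot independence).  Consequence for Smith 2016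
Thm. 2.2 [Smith2016CongruentDensity]: `det [[A + Aᵀ, Aᵀ],[A, D_z]] = Σ_π ∏_B (1 + z_B) q_z(A^B)` for
every zero-row-sum `A` (file `Smith2016/CongruentNumberGenusDeterminantForest`).
-/

namespace Literature.LinearAlgebra.Matrix

open _root_.Matrix Finset Literature.Combinatorics.Enumerative

variable {V : Type*} [Fintype V] [LinearOrder V]

/-- `κ_t(B)`: the determinant of the Laplacian-type matrix of `B` with row and column `t` deleted
(`= L_{B ∖ t}` with the extra diagonal `a • t`), i.e. the mod-2 count of spanning arborescences of
`B` converging to `t`. [cite: ChebotarevAgaev2002, §3 Thm. 1 (matrix-tree theorem)] -/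
def treeDet (a : V → V → ZMod 2) (B : Finset V) (t : V) : ZMod 2 :=
  (lap a (B.erase t) (fun i => a i t)).det

/-- `q_x(B) = Σ_{t ∈ B} x t · κ_t(B)` (root weights `x`). [cite: ChebotarevAgaev2002, §3 Thm. 2 (in-forests with prescribed roots)] -/
def qwt (a : V → V → ZMod 2) (x : V → ZMod 2) (B : Finset V) : ZMod 2 :=
  ∑ t ∈ B, x t * treeDet a B t

/-- The block weight of the forest formula: `(Σ_{i∈B} y i) · q_z(B) + q_ℓ(B)` (a tree with one
`z`-root and one `y`-mark, or one `ℓ`-root). [cite: Chaiken1982, §2 (all minors matrix tree theorem: one root of `W` and one vertex of `U` per tree)] -/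
def fwt (a : V → V → ZMod 2) (y z ℓ : V → ZMod 2) (B : Finset V) : ZMod 2 :=
  (∑ i ∈ B, y i) * qwt a z B + qwt a ℓ B

omit [Fintype V] in
/-- `lap` only depends on the weights inside `D` and on `ℓ` on `D`. [cite: Chaiken1982, §2] -/
theorem lap_congr {a a' : V → V → ZMod 2} {D : Finset V} {ℓ ℓ' : V → ZMod 2}
    (ha : ∀ k ∈ D, ∀ i ∈ D, k ≠ i → a k i = a' k i) (hℓ : ∀ i ∈ D, ℓ i = ℓ' i) :
    lap a D ℓ = lap a' D ℓ' := by
  ext i j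
  simp only [lap_apply]
  by_cases h : i ∈ D ∧ j ∈ D
  · rw [if_pos h, if_pos h]
    by_cases hij : i = j
    · subst hij
      rw [if_pos rfl, if_pos rfl, hℓ i h.1,
        sum_congr rfl fun k hk => ha i h.1 k (mem_of_mem_erase hk) (ne_of_mem_erase hk).symm]
    · rw [if_neg hij, if_neg hij, ha i h.1 j h.2 hij]
  · rw [if_neg h, if_neg h]

/-- `treeDet a B t` (`t ∈ B`) only depends on the weights inside `B`. [cite: ChebotarevAgaev2002, §3 Thm. 1] -/
theorem treeDet_congr {a a' : V → V → ZMod 2} {B : Finset V}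
    (ha : ∀ k ∈ B, ∀ i ∈ B, k ≠ i → a k i = a' k i) {t : V} (ht : t ∈ B) :
    treeDet a B t = treeDet a' B t := by
  unfold treeDet
  rw [lap_congr (fun k hk i hi hki => ha k (mem_of_mem_erase hk) i (mem_of_mem_erase hi) hki)
    (fun i hi => ha i (mem_of_mem_erase hi) t ht (ne_of_mem_erase hi))]

/-- `qwt` only depends on the weights inside `B` and on `x` on `B`. [cite: ChebotarevAgaev2002, §3 Thm. 2] -/
theorem qwt_congr {a a' : V → V → ZMod 2} {x x' : V → ZMod 2} {B : Finset V}
    (ha : ∀ k ∈ B, ∀ i ∈ B, k ≠ i → a k i = a' k i) (hx : ∀ i ∈ B, x i = x' i) :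
    qwt a x B = qwt a' x' B := by
  unfold qwt
  exact sum_congr rfl fun t ht => by rw [hx t ht, treeDet_congr ha ht]

/-- `fwt` only depends on the data inside `B`. [cite: Chaiken1982, §2] -/
theorem fwt_congr {a a' : V → V → ZMod 2} {y y' z ℓ : V → ZMod 2} {B : Finset V}
    (ha : ∀ k ∈ B, ∀ i ∈ B, k ≠ i → a k i = a' k i) (hy : ∀ i ∈ B, y i = y' i) :
    fwt a y z ℓ B = fwt a' y' z ℓ B := by
  unfold fwt
  rw [sum_congr rfl hy, qwt_congr ha (fun _ _ => rfl), qwt_congr ha (fun _ _ => rfl)]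

/-- `q` is additive in the root weights. [cite: ChebotarevAgaev2002, §3 Thm. 2] -/
theorem qwt_add (a : V → V → ZMod 2) (x x' : V → ZMod 2) (B : Finset V) :
    qwt a (fun i => x i + x' i) B = qwt a x B + qwt a x' B := by
  unfold qwt
  rw [← sum_add_distrib]
  exact sum_congr rfl fun t _ => by ring

/-- Shifting the root weights adds a `q`-term to the block weight. [cite: Chaiken1982, §2] -/
theorem fwt_add_root (a : V → V → ZMod 2) (y z ℓ ℓ' : V → ZMod 2) :
    fwt a y z (fun i => ℓ i + ℓ' i) = fwt a y z ℓ + qwt a ℓ' := by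
  funext B
  rw [Pi.add_apply, fwt, fwt, qwt_add]
  ring

/-- With no marks and no `z`-roots the block weight is `q_ℓ`. [cite: ChebotarevAgaev2002, §3 Thm. 2] -/
theorem fwt_zero_zero (a : V → V → ZMod 2) (ℓ : V → ZMod 2) :
    fwt a 0 0 ℓ = qwt a ℓ := by
  funext B
  simp [fwt, qwt]

/-- **Root absorption**: shifting the root weights by `ℓ'` convolves the set exponential with the
exponential of `q_{ℓ'}`. [cite: ChebotarevAgaev2002, §4 Thm. 3 (matrix-forest theorem: `det (I + L)` counts all rooted forests)] -/
theorem setExp_fwt_add_root (a : V → V → ZMod 2) (y z ℓ ℓ' : V → ZMod 2) (S : Finset V) :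
    setExp (fwt a y z (fun i => ℓ i + ℓ' i)) S =
      ∑ E ∈ S.powerset, setExp (qwt a ℓ') E * setExp (fwt a y z ℓ) (S \ E) := by
  rw [fwt_add_root, setExp_add]

omit [Fintype V] in
/-- Pointed subsets: `Σ_{k ∈ T} Σ_{C₀ ⊆ T ∖ k} φ k ({k} ∪ C₀) = Σ_{C ⊆ T} Σ_{k ∈ C} φ k C`.
[cite: Stanley1999EC2, Cor. 5.1.6 (exponential formula; elementary finite form)] -/
theorem sum_sum_powerset_erase_insert {R : Type*} [AddCommMonoid R] (T : Finset V)
    (φ : V → Finset V → R) :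
    ∑ k ∈ T, ∑ C₀ ∈ (T.erase k).powerset, φ k (insert k C₀) = ∑ C ∈ T.powerset, ∑ k ∈ C, φ k C := by
  rw [sum_comm' (t' := T) (s' := fun k => T.powerset.filter (fun C => k ∈ C))
    (fun C k => by
      simp only [mem_powerset, mem_filter]
      exact ⟨fun ⟨hC, hk⟩ => ⟨⟨hC, hk⟩, hC hk⟩, fun ⟨⟨hC, hk⟩, _⟩ => ⟨hC, hk⟩⟩)]
  refine sum_congr rfl fun k hk => ?_
  have himg : T.powerset.filter (fun C => k ∈ C) = (T.erase k).powerset.image (insert k) := by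
    ext C
    simp only [mem_filter, mem_powerset, mem_image]
    constructor
    · rintro ⟨hC, hkC⟩
      exact ⟨C.erase k, fun x hx => mem_erase.mpr ⟨ne_of_mem_erase hx, hC (mem_of_mem_erase hx)⟩,
        insert_erase hkC⟩
    · rintro ⟨C₀, hC₀, rfl⟩
      exact ⟨insert_subset hk (hC₀.trans (erase_subset _ _)), mem_insert_self _ _⟩
  rw [himg, sum_image]
  intro C₀ hC₀ C₁ hC₁ h
  rw [mem_coe, mem_powerset] at hC₀ hC₁
  have h0 : k ∉ C₀ := fun hh => notMem_erase k T (hC₀ hh)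
  have h1 : k ∉ C₁ := fun hh => notMem_erase k T (hC₁ hh)
  rw [← erase_insert h0, ← erase_insert h1, h]

/-- The formula packaged as a predicate on vertex sets: the doubled determinant equals the set
exponential of the block weights, for all data. [cite: Chaiken1982, §2 (all minors matrix tree theorem)] -/
def ForestFormulaHolds (D : Finset V) : Prop :=
  ∀ (a : V → V → ZMod 2) (y z ℓ : V → ZMod 2), (bigN a D y z ℓ).det = setExp (fwt a y z ℓ) D

/-- The companion formula for an unweighted root `s` (root copy of `s` unitized): sum over the
block `{s} ∪ B₀` of `(Σ_{i∈B} y i) · κ_s(B)` times the set exponential of the rest.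
[cite: Chaiken1982, §2 (forests with a prescribed root)] -/
def RootedFormulaHolds (D : Finset V) : Prop :=
  ∀ s ∈ D, ∀ (a : V → V → ZMod 2) (y z ℓ : V → ZMod 2),
    (unitize (bigN a D y z ℓ) (Sum.inr s)).det =
      ∑ B₀ ∈ (D.erase s).powerset, (∑ i ∈ insert s B₀, y i) * treeDet a (insert s B₀) s *
        setExp (fwt a y z ℓ) (D.erase s \ B₀)

/-- **`Λ = κ`**: granted the forest formula on `B₀`, the set exponential of `q_{a•s}` over `B₀` is
the arborescence count of `{s} ∪ B₀` converging to `s` ("cut the root"). [cite: ChebotarevAgaev2002, §3 Thm. 1–2] -/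
theorem setExp_qwt_col_eq_treeDet {B₀ : Finset V} (hB₀ : ForestFormulaHolds B₀)
    (a : V → V → ZMod 2) {s : V} (hs : s ∉ B₀) :
    setExp (qwt a (fun i => a i s)) B₀ = treeDet a (insert s B₀) s := by
  rw [treeDet, erase_insert hs, ← det_bigN_zero_zero, hB₀ a 0 0 (fun i => a i s), fwt_zero_zero]

/-- **Contraction of the arborescence count**: for `s ∉ B₀`, `t ∈ B₀`,
`κ_t({s} ∪ B₀) = Σ_{j ∈ B₀} a s j · κ_t^{a/(s→j)}(B₀)` (the deletion–contraction recursion at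
`y = z = 0`). [cite: Chaiken1982, §2 (deletion–contraction)] -/
theorem treeDet_insert_eq_sum_contract (a : V → V → ZMod 2) {B₀ : Finset V} {s t : V}
    (hs : s ∉ B₀) (ht : t ∈ B₀) :
    treeDet a (insert s B₀) t = ∑ j ∈ B₀, a s j * treeDet (contractWt a s j) B₀ t := by
  have hst : s ≠ t := fun h => hs (h ▸ ht)
  have hsD : s ∈ (insert s B₀).erase t := mem_erase.mpr ⟨hst, mem_insert_self s B₀⟩
  have hset : ((insert s B₀).erase t).erase s = B₀.erase t := by
    rw [erase_right_comm, erase_insert hs]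
  rw [treeDet, ← det_bigN_zero_zero, det_bigN_rec a hsD 0 0 (fun i => a i t), hset]
  simp only [Pi.zero_apply, zero_mul, zero_add]
  rw [← add_sum_erase _ _ ht]
  congr 1
  · -- the arc `s → t`
    rw [treeDet, det_bigN_zero_zero,
      lap_congr (a := a) (a' := contractWt a s t) (ℓ := fun i => a i t + a i s)
        (ℓ' := fun i => contractWt a s t i t)
        (fun k _ i hi _ => (contractWt_of_ne a s t k (ne_of_mem_erase hi)).symm)
        (fun i _ => by rw [contractWt_apply, if_pos rfl])]
  · refine sum_congr rfl fun j hj => ?_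
    have hjt : j ≠ t := ne_of_mem_erase hj
    rw [treeDet]
    have hy : (fun i : V => if i = j then (0 : ZMod 2) else 0) = (0 : V → ZMod 2) := by
      funext i; split_ifs <;> rfl
    rw [hy, det_bigN_zero_zero,
      lap_congr (a := contractWt a s j) (a' := contractWt a s j) (ℓ := fun i => a i t)
        (ℓ' := fun i => contractWt a s j i t) (fun _ _ _ _ _ => rfl)
        (fun i _ => (contractWt_of_ne a s j i hjt.symm).symm)]

/-- Inductive step, rooted part: the forest formula below `D` gives the rooted formula on `D`.
[cite: Chaiken1982, §2] [cite: Smith2016CongruentDensity, §2.1 Prop. 2.5] -/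
theorem rootedFormula_of_forall_lt {D : Finset V}
    (ih : ∀ D' : Finset V, D'.card < D.card → ForestFormulaHolds D' ∧ RootedFormulaHolds D') :
    RootedFormulaHolds D := by
  intro s hs a y z ℓ
  set D₀ := D.erase s with hD₀
  have hcard : D₀.card < D.card := card_erase_lt_of_mem hs
  have hsD₀ : s ∉ D₀ := notMem_erase s D
  obtain ⟨hF, hR⟩ := ih D₀ hcard
  set ℓ' : V → ZMod 2 := fun i => ℓ i + a i s with hℓ'
  set G : Finset V → ZMod 2 := fun S => setExp (fwt a y z ℓ) S with hG
  set Λ : Finset V → ZMod 2 := fun E => setExp (qwt a (fun i => a i s)) E with hΛ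
  have hΛκ : ∀ E, E ⊆ D₀ → Λ E = treeDet a (insert s E) s := by
    intro E hE
    have hFE : ForestFormulaHolds E := by
      rcases (card_le_card hE).lt_or_eq with hlt | heq
      · exact (ih E (hlt.trans hcard)).1
      · exact (eq_of_subset_of_card_le hE heq.ge) ▸ hF
    exact setExp_qwt_col_eq_treeDet hFE a (fun h => hsD₀ (hE h))
  have habs : ∀ S : Finset V, setExp (fwt a y z ℓ') S = ∑ E ∈ S.powerset, Λ E * G (S \ E) := by
    intro S
    rw [hℓ', setExp_fwt_add_root]
  rw [det_unitize_bigN_rec a hs, hF a y z ℓ', habs D₀]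
  have hk : ∀ k ∈ D₀, a k s * (unitize (bigN a D₀ y z ℓ') (Sum.inr k)).det =
      ∑ C₀ ∈ (D₀.erase k).powerset, ∑ E ∈ (D₀ \ insert k C₀).powerset,
        a k s * ((∑ i ∈ insert k C₀, y i) * treeDet a (insert k C₀) k *
          (Λ E * G ((D₀ \ insert k C₀) \ E))) := by
    intro k hkD
    rw [hR k hkD a y z ℓ', mul_sum]
    refine sum_congr rfl fun C₀ hC₀ => ?_
    rw [mem_powerset] at hC₀
    have hset : D₀.erase k \ C₀ = D₀ \ insert k C₀ := by
      ext x; simp only [mem_sdiff, mem_erase, mem_insert]; tauto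
    rw [hset, habs, mul_sum, mul_sum]
  rw [sum_congr rfl hk, sum_sum_powerset_erase_insert D₀ (fun k C =>
    ∑ E ∈ (D₀ \ C).powerset, a k s * ((∑ i ∈ C, y i) * treeDet a C k * (Λ E * G ((D₀ \ C) \ E))))]
  have hsplit : ∀ B₀ ∈ D₀.powerset, (∑ i ∈ insert s B₀, y i) * treeDet a (insert s B₀) s *
      G (D₀ \ B₀) = y s * (Λ B₀ * G (D₀ \ B₀)) + (∑ i ∈ B₀, y i) * Λ B₀ * G (D₀ \ B₀) := by
    intro B₀ hB₀
    rw [mem_powerset] at hB₀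
    rw [sum_insert (fun h => hsD₀ (hB₀ h)), ← hΛκ B₀ hB₀]
    ring
  rw [sum_congr rfl hsplit, sum_add_distrib, ← mul_sum]
  congr 1
  have hpoint : ∀ B₀ ∈ D₀.powerset, (∑ i ∈ B₀, y i) * Λ B₀ * G (D₀ \ B₀) =
      ∑ C ∈ B₀.powerset, (∑ i ∈ C, y i) * (qwt a (fun i => a i s) C * Λ (B₀ \ C)) *
        G (D₀ \ B₀) := by
    intro B₀ _
    rw [hΛ, ← setExp_point, sum_mul]
  rw [sum_congr rfl hpoint, sum_powerset_sum_powerset_sub]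
  refine sum_congr rfl fun C hC => ?_
  rw [mem_powerset] at hC
  rw [sum_comm]
  refine sum_congr rfl fun E hE => ?_
  rw [mem_powerset] at hE
  have h1 : (C ∪ E) \ C = E := union_sdiff_cancel_left (disjoint_of_subset_right hE disjoint_sdiff)
  have h2 : D₀ \ (C ∪ E) = (D₀ \ C) \ E := by rw [sdiff_sdiff_left, sup_eq_union]
  rw [h1, h2, qwt,
    show ∑ k ∈ C, a k s * ((∑ i ∈ C, y i) * treeDet a C k * (Λ E * G ((D₀ \ C) \ E))) =
      ((∑ i ∈ C, y i) * (Λ E * G ((D₀ \ C) \ E))) * ∑ k ∈ C, a k s * treeDet a C k by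
      rw [mul_sum]; exact sum_congr rfl fun k _ => by ring]
  ring


/-- **The block weight of `{s} ∪ B₀` through the contractions** (`s ∉ B₀`; `s` is a `z`-root, an
`ℓ`-root, or internal with arc `s → j`):
`fwt(B) = y(B) · z s · κ_s(B) + ℓ s · κ_s(B) + Σ_{j ∈ B₀} a s j · fwt^{a/(s→j), y + y s e_j}(B₀)`.
[cite: Chaiken1982, §2 (deletion–contraction)] [cite: Smith2016CongruentDensity, §2.1 Prop. 2.4] -/
theorem fwt_insert_eq (a : V → V → ZMod 2) {B₀ : Finset V} {s : V} (hs : s ∉ B₀)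
    (y z ℓ : V → ZMod 2) :
    fwt a y z ℓ (insert s B₀) =
      (∑ i ∈ insert s B₀, y i) * (z s * treeDet a (insert s B₀) s) +
        ℓ s * treeDet a (insert s B₀) s +
        ∑ j ∈ B₀, a s j *
          fwt (contractWt a s j) (fun i => if i = j then y j + y s else y i) z ℓ B₀ := by
  set Y := ∑ i ∈ insert s B₀, y i with hY
  have hκ : ∀ t ∈ B₀, treeDet a (insert s B₀) t =
      ∑ j ∈ B₀, a s j * treeDet (contractWt a s j) B₀ t :=
    fun t ht => treeDet_insert_eq_sum_contract a hs ht
  have hy : ∀ j ∈ B₀, ∑ i ∈ B₀, (if i = j then y j + y s else y i) = Y := by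
    intro j hj
    rw [hY, sum_insert hs, ← add_sum_erase _ _ hj, ← add_sum_erase B₀ y hj, if_pos rfl,
      sum_congr rfl fun i hi => if_neg (ne_of_mem_erase hi)]
    ring
  have e0 : ∀ j ∈ B₀, fwt (contractWt a s j) (fun i => if i = j then y j + y s else y i) z ℓ B₀ =
      Y * (∑ t ∈ B₀, z t * treeDet (contractWt a s j) B₀ t) +
        ∑ t ∈ B₀, ℓ t * treeDet (contractWt a s j) B₀ t := by
    intro j hj
    simp only [fwt, qwt]
    rw [hy j hj]
  have ez : ∑ t ∈ B₀, z t * treeDet a (insert s B₀) t =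
      ∑ t ∈ B₀, z t * ∑ j ∈ B₀, a s j * treeDet (contractWt a s j) B₀ t :=
    sum_congr rfl fun t ht => by rw [hκ t ht]
  have eℓ : ∑ t ∈ B₀, ℓ t * treeDet a (insert s B₀) t =
      ∑ t ∈ B₀, ℓ t * ∑ j ∈ B₀, a s j * treeDet (contractWt a s j) B₀ t :=
    sum_congr rfl fun t ht => by rw [hκ t ht]
  have e1 : ∑ t ∈ B₀, z t * ∑ j ∈ B₀, a s j * treeDet (contractWt a s j) B₀ t =
      ∑ j ∈ B₀, a s j * ∑ t ∈ B₀, z t * treeDet (contractWt a s j) B₀ t := by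
    simp only [mul_sum]
    rw [sum_comm]
    exact sum_congr rfl fun j _ => sum_congr rfl fun t _ => by ring
  have e2 : ∑ t ∈ B₀, ℓ t * ∑ j ∈ B₀, a s j * treeDet (contractWt a s j) B₀ t =
      ∑ j ∈ B₀, a s j * ∑ t ∈ B₀, ℓ t * treeDet (contractWt a s j) B₀ t := by
    simp only [mul_sum]
    rw [sum_comm]
    exact sum_congr rfl fun j _ => sum_congr rfl fun t _ => by ring
  have e3 : ∑ j ∈ B₀, a s j * (Y * ∑ t ∈ B₀, z t * treeDet (contractWt a s j) B₀ t +
      ∑ t ∈ B₀, ℓ t * treeDet (contractWt a s j) B₀ t) =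
      Y * ∑ j ∈ B₀, a s j * ∑ t ∈ B₀, z t * treeDet (contractWt a s j) B₀ t +
        ∑ j ∈ B₀, a s j * ∑ t ∈ B₀, ℓ t * treeDet (contractWt a s j) B₀ t := by
    rw [mul_sum, ← sum_add_distrib]
    exact sum_congr rfl fun j _ => by ring
  rw [sum_congr rfl fun j hj => by rw [e0 j hj]]
  simp only [fwt, qwt]
  rw [← hY, sum_insert hs, sum_insert hs, ez, eℓ, e1, e2, e3]
  ring

omit [Fintype V] in
/-- The doubled matrix of the empty vertex set is the identity. [cite: Smith2016CongruentDensity, §2.1 ("The 0 × 0 matrix is nonsingular")] -/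
theorem bigN_empty (a : V → V → ZMod 2) (y z ℓ : V → ZMod 2) :
    bigN a (∅ : Finset V) y z ℓ = 1 := by
  ext (i | i) (k | k)
  · rw [bigN_inl_inl]; by_cases hik : i = k <;> simp [hik, one_apply]
  · rw [bigN_inl_inr, lapIn_apply]; simp [one_apply]
  · rw [bigN_inr_inl, lapIn_apply]; simp [one_apply]
  · rw [bigN_inr_inr]; by_cases hik : i = k <;> simp [hik, one_apply]

/-- Inductive step, main part: the forest formula below `D` and the rooted formula on `D` give the
forest formula on `D`. [cite: Chaiken1982, §2] [cite: Smith2016CongruentDensity, §2.1 Prop. 2.4] -/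
theorem forestFormula_of_forall_lt {D : Finset V}
    (ih : ∀ D' : Finset V, D'.card < D.card → ForestFormulaHolds D' ∧ RootedFormulaHolds D')
    (hroot : RootedFormulaHolds D) : ForestFormulaHolds D := by
  intro a y z ℓ
  by_cases hD : D.Nonempty
  swap
  · rw [not_nonempty_iff_eq_empty] at hD
    subst hD
    rw [setExp_empty, bigN_empty, det_one]
  obtain ⟨s, hs⟩ := hD
  set D₀ := D.erase s with hD₀
  have hcard : D₀.card < D.card := card_erase_lt_of_mem hs
  have hsD₀ : s ∉ D₀ := notMem_erase s D
  obtain ⟨hF, hR⟩ := ih D₀ hcard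
  have hΛκ : ∀ E, E ⊆ D₀ → setExp (qwt a (fun i => a i s)) E = treeDet a (insert s E) s := by
    intro E hE
    have hFE : ForestFormulaHolds E := by
      rcases (card_le_card hE).lt_or_eq with hlt | heq
      · exact (ih E (hlt.trans hcard)).1
      · exact (eq_of_subset_of_card_le hE heq.ge) ▸ hF
    exact setExp_qwt_col_eq_treeDet hFE a (fun h => hsD₀ (hE h))
  have habs : setExp (fwt a y z (fun i => ℓ i + a i s)) D₀ =
      ∑ E ∈ D₀.powerset, setExp (qwt a (fun i => a i s)) E * setExp (fwt a y z ℓ) (D₀ \ E) :=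
    setExp_fwt_add_root a y z ℓ (fun i => a i s) D₀
  have hcontr : ∀ j ∈ D₀,
      (bigN (contractWt a s j) D₀ (fun i => if i = j then y j + y s else y i) z ℓ).det =
      ∑ B₀ ∈ (D₀.erase j).powerset,
        fwt (contractWt a s j) (fun i => if i = j then y j + y s else y i) z ℓ (insert j B₀) *
          setExp (fwt a y z ℓ) (D₀ \ insert j B₀) := by
    intro j hj
    rw [hF, setExp_peel _ hj]
    refine sum_congr rfl fun B₀ hB₀ => ?_
    rw [mem_powerset] at hB₀
    have hset : D₀.erase j \ B₀ = D₀ \ insert j B₀ := by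
      ext x; simp only [mem_sdiff, mem_erase, mem_insert]; tauto
    rw [hset]
    congr 1
    refine setExp_congr fun C hC _ => fwt_congr (fun k _ i hi _ => ?_) (fun i hi => ?_)
    · have hij : i ≠ j := fun h => (mem_sdiff.mp (hC hi)).2 (h ▸ mem_insert_self j B₀)
      exact contractWt_of_ne a s j k hij
    · have hij : i ≠ j := fun h => (mem_sdiff.mp (hC hi)).2 (h ▸ mem_insert_self j B₀)
      rw [if_neg hij]
  have hsum3 : ∑ j ∈ D₀, a s j *
      (bigN (contractWt a s j) D₀ (fun i => if i = j then y j + y s else y i) z ℓ).det =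
      ∑ j ∈ D₀, ∑ B₀ ∈ (D₀.erase j).powerset, a s j *
        (fwt (contractWt a s j) (fun i => if i = j then y j + y s else y i) z ℓ (insert j B₀) *
          setExp (fwt a y z ℓ) (D₀ \ insert j B₀)) :=
    sum_congr rfl fun j hj => by rw [hcontr j hj, mul_sum]
  rw [det_bigN_rec a hs, hroot s hs a y z ℓ, ← hD₀, hF a y z _, habs, hsum3,
    sum_sum_powerset_erase_insert D₀ (fun j B₀ => a s j *
      (fwt (contractWt a s j) (fun i => if i = j then y j + y s else y i) z ℓ B₀ *
        setExp (fwt a y z ℓ) (D₀ \ B₀))),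
    setExp_peel _ hs, ← hD₀, mul_sum, mul_sum, ← sum_add_distrib, ← sum_add_distrib]
  refine sum_congr rfl fun B₀ hB₀ => ?_
  rw [mem_powerset] at hB₀
  have hsB₀ : s ∉ B₀ := fun h => hsD₀ (hB₀ h)
  rw [fwt_insert_eq a hsB₀, ← hΛκ B₀ hB₀]
  have e : (∑ j ∈ B₀, a s j *
      fwt (contractWt a s j) (fun i => if i = j then y j + y s else y i) z ℓ B₀) *
        setExp (fwt a y z ℓ) (D₀ \ B₀) =
      ∑ j ∈ B₀, a s j *
      (fwt (contractWt a s j) (fun i => if i = j then y j + y s else y i) z ℓ B₀ *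
        setExp (fwt a y z ℓ) (D₀ \ B₀)) := by
    rw [sum_mul]
    exact sum_congr rfl fun j _ => by ring
  rw [add_mul, add_mul, e]
  ring

/-- **The bipartite all-minors matrix-forest formula over `𝔽₂`** (and its rooted companion), by
strong induction on the number of vertices. [cite: Chaiken1982, §2 (all minors matrix tree theorem)] -/
theorem forestFormula_and_rooted (D : Finset V) : ForestFormulaHolds D ∧ RootedFormulaHolds D := by
  suffices H : ∀ (n : ℕ) (D : Finset V), D.card = n → ForestFormulaHolds D ∧ RootedFormulaHolds D from
    H _ D rfl
  intro n
  induction n using Nat.strong_induction_on with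
  | _ n ih =>
  intro D hn
  have ih' : ∀ D' : Finset V, D'.card < D.card → ForestFormulaHolds D' ∧ RootedFormulaHolds D' :=
    fun D' hD' => ih D'.card (hn ▸ hD') D' rfl
  have hroot := rootedFormula_of_forall_lt ih'
  exact ⟨forestFormula_of_forall_lt ih' hroot, hroot⟩

/-- **The bipartite all-minors matrix-forest formula over `𝔽₂`**:
`det [[D_y, Pᵀ], [P, D_z]] = Σ_{π ∈ Partitions(D)} ∏_{B ∈ π} ((Σ_{i∈B} y i) · q_z(B) + q_ℓ(B))`,
`P = L_D + D_ℓ`, `q_x(B) = Σ_{t∈B} x t κ_t(B)`. [cite: Chaiken1982, §2 (all minors matrix tree theorem), over 𝔽₂, generating-function form] -/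
theorem det_bigN_eq_setExp (a : V → V → ZMod 2) (D : Finset V) (y z ℓ : V → ZMod 2) :
    (bigN a D y z ℓ).det = setExp (fwt a y z ℓ) D :=
  (forestFormula_and_rooted D).1 a y z ℓ

end Literature.LinearAlgebra.Matrix
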